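import Summits.KontsevichZagierPeriods.KontsevichZagierPeriods.Theorems.FurushoPentagonDoubleShuffleInKZLambdaCellsAux

/-!
# `DoubleShuffleInKZ` (stmt-KontsevichZagierPeriods-14665, route `FurushoPentagon`): the Λ-poset shuffle cells

Helper file (`--supports stmt-KontsevichZagierPeriods-14665`), line "rider lever" for the
Kaneko–Yamamoto integral–series family `IS_j(u)`.  THE INTEGRAL SIDE: the `Λ`-shaped 2-poset
integral (Kaneko–Yamamoto's `μ(k, (1^j))`; Yamamoto's 2-posets) — a top variable `t₀` carrying
`dt/t`, below it a chain of `j` rider variables carrying `dt/(1−t)` and, independently, the chain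
of the remaining letters `ε'` of a convergent word —

  `[Λ, ω] = [{1 > t₀ > v₀ > ⋯ > v_{j-1} > 0, t₀ > s₀ > ⋯ > s_{c-1} > 0}, (1/t₀) ∏ 1/(1−v_a) ∏ ω_{ε'_i}(s_i)]`

EXISTS and dissects, modulo `KZ.relations`, into the simplex classes of its linear extensions:
`[Λ, ω] ≡ Σ_{w ∈ 1ʲ ш ε'} Z(index of 0w)` (`lambda_cells`).  Exactly as the product dissection
`TwoPosets.stub_shuffleProduct` (whose coordinate lemmas are reused: the cells are the tuples sorted
along a coordinate shuffle `e` of the two chains, extended by the top variable), except that the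
rider chain alone carries NO convergent representation — only the coupling `v₀ < t₀` makes `Λ`
integrable — so the dissection is fibred over `t₀`: rule (1a) off the null tie walls `{v_a = s_i}`,
one reindexing (rule (2)) per cell.

References: M. Kontsevich, D. Zagier, *Periods* (2001), §1.2; S. Yamamoto, *Multiple zeta-star
values and multiple integrals*, RIMS Kôkyûroku Bessatsu B68 (2017); M. Kaneko, S. Yamamoto, Selecta
Math. 24 (2018), Thm 4.1.
-/

noncomputable section

open Set MeasureTheory
open Literature.NumberTheory.Transcendental
open Summit.KontsevichZagierPeriods.MzvKernelInKZ.Negative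
open Summit.KontsevichZagierPeriods.MzvKernelInKZ.TwoPosets

namespace Summit.KontsevichZagierPeriods.FurushoPentagon.DoubleShuffleInKZ

/-! ### The dissection of the Λ-domain -/

/-- **The Λ-poset integral dissects into its linear extensions.** For `j ≥ 1` riders (letters `1`)
and a chain of `c ≥ 1` letters `ε'` ending in `1`, and every `Z` pinned to Kontsevich's simplex
classes: the representation
`[{z ∈ (0,1)^{j+c+1} | riders ↓, chain ↓, both tops < z₀}, (1/z₀) ∏_a 1/(1−v_a) ∏_i ω_{ε'_i}(s_i)]`
exists, and every representation of that shape is congruent modulo `KZ.relations` to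
`Σ_{w ∈ 1ʲ ш ε'} Z(index of 0 w)` (cells = tuples sorted along the top extension of a coordinate
shuffle; rule (1a) off the null tie walls, rule (2) per cell; `TwoPosets` coordinate lemmas).
[cite: KontsevichZagier2001, §1.2] -/
theorem lambda_cells (Z : List ℕ → KZ.FormalRep)
    (hZ : ∀ (u : List ℕ) (hu : MZV.IsAdmissible u), Z u = KZ.of (KZ.mzvRep u hu
      (KZ.mzvIntegrand_isSemialgebraicFunOn_holds u) (KZ.mzvIntegrand_integrableOn_holds u hu)))
    (j c : ℕ) (hj : 0 < j) (hc : 0 < c) (ε' : Fin c → Bool)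
    (hlast : ε' ⟨c - 1, Nat.sub_one_lt_of_lt hc⟩ = true) :
    (∃ r : KZ.IntegralRep (j + c + 1),
      r.domain = {z : Fin (j + c + 1) → ℝ |
        (∀ k, z k ∈ Set.Ioo (0:ℝ) 1) ∧
        StrictAnti (fun a : Fin j => z (Fin.castAdd c a).succ) ∧
        StrictAnti (fun i : Fin c => z (Fin.natAdd j i).succ) ∧
        z (Fin.castAdd c ⟨0, hj⟩).succ < z 0 ∧ z (Fin.natAdd j ⟨0, hc⟩).succ < z 0} ∧
      r.integrand = fun z => 1 / z 0 * ((∏ a : Fin j, 1 / (1 - z (Fin.castAdd c a).succ)) *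
        ∏ i : Fin c, (if ε' i then 1 / (1 - z (Fin.natAdd j i).succ) else 1 / z (Fin.natAdd j i).succ))) ∧
    ∀ r : KZ.IntegralRep (j + c + 1),
      r.domain = {z : Fin (j + c + 1) → ℝ |
        (∀ k, z k ∈ Set.Ioo (0:ℝ) 1) ∧
        StrictAnti (fun a : Fin j => z (Fin.castAdd c a).succ) ∧
        StrictAnti (fun i : Fin c => z (Fin.natAdd j i).succ) ∧
        z (Fin.castAdd c ⟨0, hj⟩).succ < z 0 ∧ z (Fin.natAdd j ⟨0, hc⟩).succ < z 0} →
      Set.EqOn r.integrand (fun z => 1 / z 0 * ((∏ a : Fin j, 1 / (1 - z (Fin.castAdd c a).succ)) *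
        ∏ i : Fin c, (if ε' i then 1 / (1 - z (Fin.natAdd j i).succ) else 1 / z (Fin.natAdd j i).succ)))
        r.domain →
      KZ.of r - ((MZV.shuffleWord (List.replicate j true) (List.ofFn ε')).map fun w =>
        Z (MZV.ofBinaryWord (false :: w))).sum ∈ KZ.relations := by
  have hM : 0 < j + c := by omega
  -- the coordinate shuffles and their top extensions
  obtain ⟨Ncell, e, hmem, hinj, hsurj⟩ := exists_enum_coordShuffles j c
  let L : Fin (j + c) → Bool := Fin.append (fun _ : Fin j => true) ε'
  let E : Fin Ncell → (Fin (j + c + 1) ≃ Fin (j + c + 1)) :=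
    fun i => (finSuccEquiv (j + c)).trans ((e i).optionCongr.trans (finSuccEquiv (j + c)).symm)
  have hE0 : ∀ i, E i 0 = 0 := fun i => consPerm_apply_zero (e i)
  have hEs : ∀ i (p : Fin (j + c)), E i p.succ = (e i p).succ := fun i p => consPerm_apply_succ (e i) p
  let W : Fin Ncell → (Fin (j + c + 1) → Bool) := fun i => Fin.cons false (fun p => L (e i p))
  have hW0 : ∀ i, W i 0 = false := fun i => Fin.cons_zero _ _
  have hWs : ∀ i (p : Fin (j + c)), W i p.succ = L (e i p) := fun i p => Fin.cons_succ _ _ _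
  have hadm : ∀ i, Adm (W i) := by
    intro i h
    constructor
    · exact hW0 i
    · have hl : (⟨j + c + 1 - 1, Nat.sub_one_lt_of_lt h⟩ : Fin (j + c + 1)) =
          (⟨j + c - 1, by omega⟩ : Fin (j + c)).succ := Fin.ext (by simp; omega)
      rw [hl, hWs]
      exact append_last_of_mem_shuffleWord hj hc ε' hlast (hmem i)
  -- the cells: canonical word representations read along the top extensions
  let R : Fin Ncell → KZ.IntegralRep (j + c + 1) := fun i => (wordRep (W i) 1 (hadm i)).reindex (E i)
  have hRdom : ∀ i (z : Fin (j + c + 1) → ℝ), z ∈ (R i).domain ↔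
      z 0 ∈ Set.Ioo (0:ℝ) 1 ∧ (fun p => z (e i p).succ) ∈ simplex (j + c) ∧ z (e i ⟨0, hM⟩).succ < z 0 := by
    intro i z
    show (fun k => z (E i k)) ∈ simplex (j + c + 1) ↔ _
    exact comp_consPerm_mem_simplex_iff hM (e i) z
  -- the word integrand along the top extension is the Λ-integrand
  have hRint : ∀ i (z : Fin (j + c + 1) → ℝ), (R i).integrand z =
      1 / z 0 * ((∏ a : Fin j, 1 / (1 - z (Fin.castAdd c a).succ)) *
        ∏ i : Fin c, (if ε' i then 1 / (1 - z (Fin.natAdd j i).succ) else 1 / z (Fin.natAdd j i).succ)) := by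
    intro i z
    show wordFun (W i) 1 (fun k => z (E i k)) = _
    have hsplit : wordFun (W i) 1 (fun k => z (E i k)) =
        1 / z 0 * wordFun (fun p => Fin.append (fun _ : Fin j => true) ε' (e i p)) 1
          (fun p => (fun q : Fin (j + c) => z q.succ) (e i p)) := by
      simp only [wordFun, Rat.cast_one, one_mul]
      rw [Fin.prod_univ_succ, hE0, hW0]
      simp only [Bool.false_eq_true, if_false, hEs, hWs, L]
    rw [hsplit, wordFun_append_comp_equiv (fun _ : Fin j => true) ε' (e i) (fun q : Fin (j + c) => z q.succ)]
    simp only [wordFun, Rat.cast_one, one_mul, if_true]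
  -- ### the Λ-domain
  set Λ : Set (Fin (j + c + 1) → ℝ) := {z : Fin (j + c + 1) → ℝ |
      (∀ k, z k ∈ Set.Ioo (0:ℝ) 1) ∧
      StrictAnti (fun a : Fin j => z (Fin.castAdd c a).succ) ∧
      StrictAnti (fun i : Fin c => z (Fin.natAdd j i).succ) ∧
      z (Fin.castAdd c ⟨0, hj⟩).succ < z 0 ∧ z (Fin.natAdd j ⟨0, hc⟩).succ < z 0} with hΛ_def
  have hΛsa : Literature.ModelTheory.ExponentialFields.IsSemialgebraic ℚ Λ :=
    isSemialgebraic_lambdaDomain j c hj hc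
  have hΛm : MeasurableSet Λ := Literature.ModelTheory.ExponentialFields.IsSemialgebraic.measurableSet_holds hΛsa
  -- every entry of the lower block of a point of `Λ` is below `z 0`
  have hbelow : ∀ z ∈ Λ, ∀ q : Fin (j + c), z q.succ < z 0 := by
    rintro z ⟨-, hv, hs, hvt, hst⟩ q
    induction q using Fin.addCases with
    | left a =>
      rcases Nat.eq_zero_or_pos (a : ℕ) with h | h
      · have ha : a = ⟨0, hj⟩ := Fin.ext h
        rw [ha]; exact hvt
      · exact (hv (show (⟨0, hj⟩ : Fin j) < a from h)).trans hvt
    | right i =>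
      rcases Nat.eq_zero_or_pos (i : ℕ) with h | h
      · have hi : i = ⟨0, hc⟩ := Fin.ext h
        rw [hi]; exact hst
      · exact (hs (show (⟨0, hc⟩ : Fin c) < i from h)).trans hst
  -- cells lie in `Λ`
  have hRsub : ∀ i, (R i).domain ⊆ Λ := by
    intro i z hz
    rw [hRdom] at hz
    obtain ⟨h0, hy, htop⟩ := hz
    obtain ⟨hv, hs⟩ := mem_simplex_of_comp_mem_simplex (z := fun q : Fin (j + c) => z q.succ) (hmem i) hy
    have hall : ∀ q : Fin (j + c), z q.succ < z 0 := by
      intro q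
      obtain ⟨p, rfl⟩ := (e i).surjective q
      rcases Nat.eq_zero_or_pos (p : ℕ) with hp | hp
      · have hp' : p = ⟨0, hM⟩ := Fin.ext hp
        rw [hp']; exact htop
      · exact (hy.2.2 (show (⟨0, hM⟩ : Fin (j + c)) < p from hp)).trans htop
    refine ⟨fun k => ?_, hv.2.2, hs.2.2, hall _, hall _⟩
    refine Fin.cases h0 (fun q => ⟨hy.1 ((e i).symm q) |> fun h => by simpa using h,
      hy.2.1 ((e i).symm q) |> fun h => by simpa using h⟩) k
  -- the tie walls
  have hwall : volume (⋃ a : Fin j, ⋃ b : Fin c,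
      {z : Fin (j + c + 1) → ℝ | z (Fin.castAdd c a).succ = z (Fin.natAdd j b).succ}) = 0 :=
    measure_iUnion_null_iff.2 fun a => measure_iUnion_null_iff.2 fun b =>
      volume_setOf_apply_eq_apply (n := j + c + 1) (i := (Fin.castAdd c a).succ)
        (j := (Fin.natAdd j b).succ) fun h => absurd (congrArg Fin.val h) (by simp; omega)
  -- cover off the walls
  have hcover : Λ \ (⋃ i, (R i).domain) ⊆ ⋃ a : Fin j, ⋃ b : Fin c,
      {z : Fin (j + c + 1) → ℝ | z (Fin.castAdd c a).succ = z (Fin.natAdd j b).succ} := by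
    rintro z ⟨hzΛ, hz⟩
    by_contra hne
    simp only [Set.mem_iUnion, Set.mem_setOf_eq, not_exists] at hne
    obtain ⟨h01, hv, hs, hvt, hst⟩ := hzΛ
    have hx : (fun a : Fin j => (fun q : Fin (j + c) => z q.succ) (Fin.castAdd c a)) ∈ simplex j :=
      ⟨fun a => (h01 _).1, fun a => (h01 _).2, hv⟩
    have hy : (fun b : Fin c => (fun q : Fin (j + c) => z q.succ) (Fin.natAdd j b)) ∈ simplex c :=
      ⟨fun b => (h01 _).1, fun b => (h01 _).2, hs⟩
    obtain ⟨e₀, he₀, hz₀⟩ := exists_comp_mem_simplex (z := fun q : Fin (j + c) => z q.succ) hx hy fun a b => hne a b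
    obtain ⟨i, hi⟩ := hsurj _ he₀
    have hei : e i = e₀ := Equiv.ext (congrFun (List.ofFn_injective hi))
    refine hz (Set.mem_iUnion.2 ⟨i, ?_⟩)
    rw [hRdom, hei]
    exact ⟨h01 0, hz₀, hbelow z ⟨h01, hv, hs, hvt, hst⟩ _⟩
  -- ### the Λ-integrand: semialgebraic and integrable on `Λ`
  have hωsa : IsSemialgebraicFunOn ℚ Λ (fun z => 1 / z 0 * ((∏ a : Fin j, 1 / (1 - z (Fin.castAdd c a).succ)) *
        ∏ i : Fin c, (if ε' i then 1 / (1 - z (Fin.natAdd j i).succ) else 1 / z (Fin.natAdd j i).succ))) := by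
    have h := isSemialgebraicFunOn_wordFun_of_subset (Fin.cons false L : Fin (j + c + 1) → Bool) hΛsa
      fun z hz k => hz.1 k
    refine h.congr fun z _ => ?_
    have := wordFun_append_comp_equiv (fun _ : Fin j => true) ε' (Equiv.refl _) (fun q : Fin (j + c) => z q.succ)
    simp only [Equiv.refl_apply] at this
    simp only [wordFun, Rat.cast_one, one_mul, Fin.prod_univ_succ, Fin.cons_zero, Fin.cons_succ,
      Bool.false_eq_true, if_false, if_true] at this ⊢
    rw [this]
  have hωint : IntegrableOn (fun z : Fin (j + c + 1) → ℝ => 1 / z 0 *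
      ((∏ a : Fin j, 1 / (1 - z (Fin.castAdd c a).succ)) *
        ∏ i : Fin c, (if ε' i then 1 / (1 - z (Fin.natAdd j i).succ) else 1 / z (Fin.natAdd j i).succ))) Λ := by
    have hcells : IntegrableOn (fun z : Fin (j + c + 1) → ℝ => 1 / z 0 *
        ((∏ a : Fin j, 1 / (1 - z (Fin.castAdd c a).succ)) *
          ∏ i : Fin c, (if ε' i then 1 / (1 - z (Fin.natAdd j i).succ) else 1 / z (Fin.natAdd j i).succ)))
        (⋃ i, (R i).domain) :=
      (integrableOn_finite_iUnion).2 fun i =>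
        (R i).integrableOn.congr_fun (fun z _ => hRint i z) (KZ.IntegralRep.measurableSet_domain_holds _)
    have hnull : IntegrableOn (fun z : Fin (j + c + 1) → ℝ => 1 / z 0 *
        ((∏ a : Fin j, 1 / (1 - z (Fin.castAdd c a).succ)) *
          ∏ i : Fin c, (if ε' i then 1 / (1 - z (Fin.natAdd j i).succ) else 1 / z (Fin.natAdd j i).succ)))
        (⋃ a : Fin j, ⋃ b : Fin c,
          {z : Fin (j + c + 1) → ℝ | z (Fin.castAdd c a).succ = z (Fin.natAdd j b).succ}) := by
      rw [IntegrableOn, Measure.restrict_eq_zero.mpr hwall]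
      exact integrable_zero_measure
    exact (hcells.union hnull).mono_set fun z hz => by
      by_cases h : z ∈ ⋃ i, (R i).domain
      · exact Or.inl h
      · exact Or.inr (hcover ⟨hz, h⟩)
  let rΛ : KZ.IntegralRep (j + c + 1) := ⟨Λ, _, hΛsa, hωsa, hωint⟩
  refine ⟨⟨rΛ, rfl, rfl⟩, fun r hrd hri => ?_⟩
  -- ### the dissection
  have hmain : KZ.of r - ∑ i, KZ.of (R i) ∈ KZ.relations := by
    refine KZ.of_sub_sum_of_mem_relations Finset.univ r R (fun i _ => ?_) (fun i _ z hz => ?_) ?_ ?_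
    · rw [hrd, Set.sdiff_eq_empty.mpr (hRsub i), measure_empty]
    · rw [hri hz.2, hRint i z]
    · rw [hrd]
      refine measure_mono_null (fun z hz => hcover ⟨hz.1, fun h => hz.2 ?_⟩) hwall
      simpa only [Finset.mem_univ, Set.iUnion_true] using h
    · intro i _ i' _ hii'
      have hempty : (R i).domain ∩ (R i').domain = ∅ := by
        refine Set.eq_empty_of_forall_notMem fun z hz => hii' (hinj i i' ?_)
        have h1 := ((hRdom i z).1 hz.1).2.1
        have h2 := ((hRdom i' z).1 hz.2).2.1
        exact ofFn_eq_of_comp_mem_simplex (z := fun q : Fin (j + c) => z q.succ) h1 h2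
      rw [hempty, measure_empty]
  -- each cell is its canonical word representation, the pinned class of its index
  have hcell : ∀ i, KZ.of (R i) - Z (MZV.ofBinaryWord (false :: (List.ofFn (e i)).map L)) ∈ KZ.relations := by
    intro i
    have h1 : KZ.of (wordRep (W i) 1 (hadm i)) - KZ.of (R i) ∈ KZ.relations :=
      KZ.of_sub_of_reindex_mem_relations _ _
    have h2 : KZ.of (wordRep (W i) 1 (hadm i)) = Z (MZV.ofBinaryWord (false :: (List.ofFn (e i)).map L)) := by
      rw [of_wordRep_eq_pinned Z hZ (Nat.succ_pos _) (W i) (hadm i)]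
      congr 2
      rw [List.ofFn_succ, hW0]
      congr 1
      rw [List.map_ofFn]
      exact congrArg List.ofFn (funext fun p => hWs i p)
    rw [← h2, ← neg_sub]
    exact KZ.relations.neg_mem h1
  -- the enumeration of the cells is the enumeration of the shuffles
  have hsum : ∑ i, Z (MZV.ofBinaryWord (false :: (List.ofFn (e i)).map L)) =
      ((MZV.shuffleWord (List.replicate j true) (List.ofFn ε')).map fun w =>
        Z (MZV.ofBinaryWord (false :: w))).sum := by
    classical
    have hl : List.replicate j true = (List.ofFn (Fin.castAdd c : Fin j → Fin (j + c))).map L := by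
      rw [List.map_ofFn, ← List.ofFn_const]
      exact congrArg List.ofFn (funext fun a => by simp [L])
    have hr : List.ofFn ε' = (List.ofFn (Fin.natAdd j : Fin c → Fin (j + c))).map L := by
      rw [List.map_ofFn]
      exact congrArg List.ofFn (funext fun b => by simp [L])
    have hnd : (MZV.shuffleWord (List.ofFn (Fin.castAdd c : Fin j → Fin (j + c)))
        (List.ofFn (Fin.natAdd j))).Nodup :=
      nodup_shuffleWord _ _ (by rw [ofFn_castAdd_append_ofFn_natAdd]; exact List.nodup_finRange _)
    rw [hl, hr, shuffleWord_map, List.map_map, ← List.sum_toFinset _ hnd]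
    refine Finset.sum_bij (fun i _ => List.ofFn (e i)) (fun i _ => List.mem_toFinset.2 (hmem i))
      (fun i _ i' _ h => hinj i i' h) (fun w hw => ?_) (fun i _ => rfl)
    obtain ⟨i, hi⟩ := hsurj w (List.mem_toFinset.1 hw)
    exact ⟨i, Finset.mem_univ _, hi⟩
  rw [← hsum]
  have : KZ.of r - ∑ i, Z (MZV.ofBinaryWord (false :: (List.ofFn (e i)).map L)) =
      (KZ.of r - ∑ i, KZ.of (R i)) +
        ∑ i, (KZ.of (R i) - Z (MZV.ofBinaryWord (false :: (List.ofFn (e i)).map L))) := by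
    rw [Finset.sum_sub_distrib]; abel
  rw [this]
  exact KZ.relations.add_mem hmain (KZ.relations.sum_mem fun i _ => hcell i)

end Summit.KontsevichZagierPeriods.FurushoPentagon.DoubleShuffleInKZ
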